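import Summits.AnomalousDissipation.AnomalousDissipation.Theses.TwoAndHalfD
import Literature.Barriers.AnomalousDissipation.GravestModeLaminarAttractorProofs
import Literature.Barriers.AnomalousDissipation.GravestModeLaminarAttractorSwept
import Literature.Analysis.FluidPDE.LerayHopfSpectralMeasurability
import Literature.Analysis.FluidPDE.DoeringFoiasPowerProofs

/-!
# First-shell rigidity for the crux `TwoAndHalfD.TwodBoundedEnergyZeroMomentum` (stmt-AnomalousDissipation-10786)

Negative-side support (cdisprove seat `refuter-cdisprove-stmt-AnomalousDissipation-10786-0`) for the
crux "some smooth divergence-free mean-zero steady `g ≠ 0` on `(UnitAddTorus (Fin 2))` admits, along `ν_j → 0`,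
ZERO-MOMENTUM global Leray–Hopf solutions with `sup_j ⟨‖v_j‖²⟩ < ∞`".  Proved here, over the
tree's objects only (no new definitions):

* `tendsto_timeMean_of_tendsto`, `longTimeAvgSup_eq_of_tendsto` — Cesàro: a locally integrable
  observable converging as `t → ∞` has long-time average (`limsup` of running means) equal to
  its limit; `tendsto_integral_norm_sq_of_tendsto_eLpNorm` — `L²` convergence ⇒ convergence of
  energies.
* `meanEnergy_eq_of_firstMode` — under the first-mode force `marchioroForce α` EVERY zero-momentum
  global Leray–Hopf solution has `⟨‖u‖²⟩ = α²/(16π⁴ν²)` exactly (Marchioro 1986 / FMRT 2001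
  App. III.A.4 through `Marchioro1986_globalAttraction_holds`): the laminar energy is forced,
  with no freedom in the data.
* `not_TwodBoundedEnergyZeroMomentum_firstMode` — hence the crux RESTRICTED TO FIRST-SHELL FORCES
  `g = marchioroForce α`, `α ≠ 0`, is false: `⟨‖v_j‖²⟩ = α²/(16π⁴ν_j²) → ∞`; and
  `not_TwodBoundedEnergyZeroMomentum_forall_force` — the `∀ g` strengthening is false.  A witness
  force must carry a Fourier mode off the first shell (the condensate regime, Gallet–Young 2013;
  Constantin–Tarfulea–Vicol 2013, arXiv:1305.7089 p. 3: open problem).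
* `hasZeroMean_slice`, `meanEnergy_le_apriori` — junk audit: momentum stays zero (constant test
  fields are admissible in `Torus.IsWeakNSSolutionForcedOn`, so the Galilean evasion of the retired
  stmt-0209 is closed), and `⟨‖u‖²⟩ ≤ ½‖u₀‖²/(2π²ν) + ‖g‖₂²/(16π⁴ν²)` (the `limsup` is honest;
  the content of the crux is uniformity in `j`).
-/

noncomputable section

open MeasureTheory Set Filter Topology UnitAddTorus
open scoped ENNReal NNReal InnerProductSpace ComplexConjugate

namespace Summit.AnomalousDissipation.AnomalousDissipation.Theorems.TwodBoundedEnergyZeroMomentum.Negative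

open Literature.Analysis.FunctionSpaces Literature.Analysis.FunctionSpaces.Torus
open Literature.Analysis.FluidPDE Literature.Analysis.FluidPDE.Torus
open Literature.Barriers.AnomalousDissipation

/-! ### Tools: Cesàro means of convergent observables; `L²` convergence of energies -/

section Cesaro

/-- **Cesàro**: if `g` is integrable on every `(0, T]` and `g(t) → L` as `t → ∞`, then the
running means `T⁻¹ ∫₀ᵀ g → L`. [folklore] -/
theorem tendsto_timeMean_of_tendsto {g : ℝ → ℝ} {L : ℝ}
    (hint : ∀ T, 0 < T → IntegrableOn g (Ioc 0 T)) (hg : Tendsto g atTop (𝓝 L)) :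
    Tendsto (timeMean g) atTop (𝓝 L) := by
  rw [Metric.tendsto_atTop]
  intro ε hε
  obtain ⟨t₁, ht₁⟩ := Metric.tendsto_atTop.1 hg (ε / 2) (half_pos hε)
  set t₀ : ℝ := max t₁ 1 with ht₀_def
  have ht₀1 : 1 ≤ t₀ := le_max_right _ _
  have ht₀0 : 0 < t₀ := one_pos.trans_le ht₀1
  have hclose : ∀ t, t₀ ≤ t → |g t - L| < ε / 2 := fun t ht => by
    have := ht₁ t ((le_max_left _ _).trans ht)
    rwa [Real.dist_eq] at this
  -- interval integrability on `[a, b]`, `0 ≤ a ≤ b`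
  have hii : ∀ a b, 0 ≤ a → a ≤ b → IntervalIntegrable g volume a b := by
    intro a b ha hab
    rcases eq_or_lt_of_le hab with rfl | hlt
    · exact IntervalIntegrable.refl
    · rw [intervalIntegrable_iff_integrableOn_Ioc_of_le hab]
      exact (hint b (ha.trans_lt hlt)).mono_set (Ioc_subset_Ioc_left ha)
  have hiiL : ∀ a b, 0 ≤ a → a ≤ b → IntervalIntegrable (fun t => g t - L) volume a b :=
    fun a b ha hab => (hii a b ha hab).sub _root_.intervalIntegrable_const
  set C : ℝ := ∫ t in (0 : ℝ)..t₀, |g t - L| with hC_def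
  have hC0 : 0 ≤ C := intervalIntegral.integral_nonneg ht₀0.le fun t _ => abs_nonneg _
  refine ⟨max t₀ (2 * C / ε + 1), fun T hT => ?_⟩
  have hTt₀ : t₀ ≤ T := (le_max_left _ _).trans hT
  have hT0 : 0 < T := ht₀0.trans_le hTt₀
  have hTC : 2 * C / ε < T := by
    have := (le_max_right _ _).trans hT
    linarith
  -- `timeMean g T - L = T⁻¹ ∫₀ᵀ (g - L)`
  have hmean : timeMean g T - L = T⁻¹ * ∫ t in (0 : ℝ)..T, (g t - L) := by
    rw [timeMean, intervalIntegral.integral_sub (hii 0 T le_rfl hT0.le) _root_.intervalIntegrable_const,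
      intervalIntegral.integral_const, sub_zero, smul_eq_mul, mul_sub, inv_mul_cancel_left₀ hT0.ne']
  -- split at `t₀`
  have hsplit : ∫ t in (0 : ℝ)..T, (g t - L) =
      (∫ t in (0 : ℝ)..t₀, (g t - L)) + ∫ t in t₀..T, (g t - L) :=
    (intervalIntegral.integral_add_adjacent_intervals (hiiL 0 t₀ le_rfl ht₀0.le)
      (hiiL t₀ T ht₀0.le hTt₀)).symm
  have h1 : |∫ t in (0 : ℝ)..t₀, (g t - L)| ≤ C := by
    rw [hC_def]
    have := intervalIntegral.norm_integral_le_integral_norm (μ := volume)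
      (f := fun t => g t - L) ht₀0.le
    simpa only [Real.norm_eq_abs] using this
  have h2 : |∫ t in t₀..T, (g t - L)| ≤ (T - t₀) * (ε / 2) := by
    have hn := intervalIntegral.norm_integral_le_integral_norm (μ := volume)
      (f := fun t => g t - L) hTt₀
    simp only [Real.norm_eq_abs] at hn
    refine hn.trans ?_
    have hmono : ∫ t in t₀..T, |g t - L| ≤ ∫ _ in t₀..T, ε / 2 :=
      intervalIntegral.integral_mono_on hTt₀ (hiiL t₀ T ht₀0.le hTt₀).abs
        _root_.intervalIntegrable_const fun t ht => (hclose t ht.1).le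
    rw [intervalIntegral.integral_const, smul_eq_mul] at hmono
    exact hmono
  have h3 : |∫ t in (0 : ℝ)..T, (g t - L)| ≤ C + T * (ε / 2) := by
    rw [hsplit]
    refine (abs_add_le _ _).trans ?_
    have : (T - t₀) * (ε / 2) ≤ T * (ε / 2) := by nlinarith
    linarith
  have hCT : C / T < ε / 2 := by
    rw [div_lt_iff₀ hT0]
    rw [div_lt_iff₀ hε] at hTC
    linarith
  rw [Real.dist_eq, hmean, abs_mul, abs_inv, abs_of_pos hT0]
  calc T⁻¹ * |∫ t in (0 : ℝ)..T, (g t - L)| ≤ T⁻¹ * (C + T * (ε / 2)) := by gcongr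
    _ = C / T + ε / 2 := by field_simp
    _ < ε / 2 + ε / 2 := by linarith
    _ = ε := by ring

/-- The long-time average (`limsup` of Cesàro means) of a convergent, locally integrable
observable is its limit. [folklore] -/
theorem longTimeAvgSup_eq_of_tendsto {g : ℝ → ℝ} {L : ℝ}
    (hint : ∀ T, 0 < T → IntegrableOn g (Ioc 0 T)) (hg : Tendsto g atTop (𝓝 L)) :
    longTimeAvgSup g = L :=
  (tendsto_timeMean_of_tendsto hint hg).limsup_eq

end Cesaro

section L2

variable {X : Type*} [MeasureSpace X] {F : Type*} [NormedAddCommGroup F]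

/-- For `f ∈ L²`, `‖f‖_{L²}² = ∫ ‖f‖²` (real form). [folklore] -/
theorem toReal_eLpNorm_sq_eq_integral_norm_sq {f : X → F} (hf : MemLp f 2 volume) :
    (eLpNorm f 2 volume).toReal ^ 2 = ∫ x, ‖f x‖ ^ 2 := by
  have hsq : eLpNorm f 2 volume ^ 2 = ∫⁻ x, ‖f x‖ₑ ^ 2 := by
    rw [eLpNorm_eq_lintegral_rpow_enorm_toReal two_ne_zero ENNReal.ofNat_ne_top]
    simp only [ENNReal.toReal_ofNat, one_div]
    rw [← ENNReal.rpow_natCast, ← ENNReal.rpow_mul]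
    norm_num
  have hrhs : ENNReal.ofReal (∫ x, ‖f x‖ ^ 2) = ∫⁻ x, ‖f x‖ₑ ^ 2 := by
    rw [ofReal_integral_eq_lintegral_ofReal (hf.integrable_norm_pow two_ne_zero)
      (ae_of_all _ fun x => by positivity)]
    refine lintegral_congr fun x => ?_
    rw [← ofReal_norm, ← ENNReal.ofReal_pow (norm_nonneg _)]
  rw [← ENNReal.toReal_pow, hsq, ← hrhs, ENNReal.toReal_ofReal (integral_nonneg fun _ => sq_nonneg _)]

/-- **`L²` convergence implies convergence of the energies**: if `u i → w` in `L²` along a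
filter, then `∫ ‖u i‖² → ∫ ‖w‖²`. [folklore] -/
theorem tendsto_integral_norm_sq_of_tendsto_eLpNorm {ι : Type*} {l : Filter ι} {u : ι → X → F}
    {w : X → F} (hu : ∀ᶠ i in l, MemLp (u i) 2 volume) (hw : MemLp w 2 volume)
    (h : Tendsto (fun i => eLpNorm (u i - w) 2 volume) l (𝓝 0)) :
    Tendsto (fun i => ∫ x, ‖u i x‖ ^ 2) l (𝓝 (∫ x, ‖w x‖ ^ 2)) := by
  set A : ι → ℝ := fun i => (eLpNorm (u i) 2 volume).toReal with hA
  set B : ℝ := (eLpNorm w 2 volume).toReal with hB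
  set D : ι → ℝ := fun i => (eLpNorm (u i - w) 2 volume).toReal with hD
  have hD0 : Tendsto D l (𝓝 0) := by
    have := (ENNReal.tendsto_toReal ENNReal.zero_ne_top).comp h
    rw [ENNReal.toReal_zero] at this
    exact this
  have hwfin : eLpNorm w 2 volume ≠ ⊤ := hw.eLpNorm_ne_top
  -- two triangle inequalities, in real form
  have htri : ∀ᶠ i in l, B - D i ≤ A i ∧ A i ≤ B + D i := by
    filter_upwards [hu] with i hui
    have hufin : eLpNorm (u i) 2 volume ≠ ⊤ := hui.eLpNorm_ne_top
    have hdfin : eLpNorm (u i - w) 2 volume ≠ ⊤ := (hui.sub hw).eLpNorm_ne_top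
    have h1 : eLpNorm (u i) 2 volume ≤ eLpNorm (u i - w) 2 volume + eLpNorm w 2 volume := by
      have heq : u i = (u i - w) + w := (sub_add_cancel _ _).symm
      conv_lhs => rw [heq]
      exact eLpNorm_add_le (hui.1.sub hw.1) hw.1 one_le_two
    have h2 : eLpNorm w 2 volume ≤ eLpNorm (w - u i) 2 volume + eLpNorm (u i) 2 volume := by
      have heq : w = (w - u i) + u i := (sub_add_cancel _ _).symm
      conv_lhs => rw [heq]
      exact eLpNorm_add_le (hw.1.sub hui.1) hui.1 one_le_two
    rw [eLpNorm_sub_comm] at h2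
    constructor
    · have := ENNReal.toReal_mono (ENNReal.add_ne_top.2 ⟨hdfin, hufin⟩) h2
      rw [ENNReal.toReal_add hdfin hufin] at this
      simp only [hA, hB, hD]
      linarith
    · have := ENNReal.toReal_mono (ENNReal.add_ne_top.2 ⟨hdfin, hwfin⟩) h1
      rw [ENNReal.toReal_add hdfin hwfin] at this
      simpa only [hA, hB, hD, add_comm] using this
  have hAB : Tendsto A l (𝓝 B) := by
    have hlow : Tendsto (fun i => B - D i) l (𝓝 B) := by
      simpa using (tendsto_const_nhds (x := B)).sub hD0
    have hup : Tendsto (fun i => B + D i) l (𝓝 B) := by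
      simpa using (tendsto_const_nhds (x := B)).add hD0
    exact tendsto_of_tendsto_of_tendsto_of_le_of_le' hlow hup (htri.mono fun i hi => hi.1)
      (htri.mono fun i hi => hi.2)
  have hsq := hAB.pow 2
  rw [hB, toReal_eLpNorm_sq_eq_integral_norm_sq hw] at hsq
  refine hsq.congr' ?_
  filter_upwards [hu] with i hui
  rw [hA]
  exact toReal_eLpNorm_sq_eq_integral_norm_sq hui

end L2

/-! ### Rigidity at the first shell: the laminar energy `α²/(16π⁴ν²)` is forced -/

section FirstMode

/-- **Energy of the first-mode force**: `∫ ‖f_β‖² = β²` (`f_β = β√2 sin(2πx₀) e₁`). [folklore] -/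
theorem integral_norm_sq_marchioroForce (β : ℝ) : ∫ x, ‖marchioroForce β x‖ ^ 2 = β ^ 2 := by
  have hrepr : marchioroForce β = realTrigPoly (freqBall 1) (marchioroForceCoeff β) := by
    rw [← fourierTruncate_marchioroForce β le_rfl, fourierTruncate_eq]
    rfl
  have hpair : ({firstModeFreq, -firstModeFreq} : Finset (Fin 2 → ℤ)) ⊆ freqBall 1 := by
    intro k hk
    simp only [Finset.mem_insert, Finset.mem_singleton] at hk
    rw [mem_freqBall, Nat.cast_one, one_pow]
    rcases hk with rfl | rfl
    · rw [freqNormSq_firstModeFreq]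
    · rw [freqNormSq_neg, freqNormSq_firstModeFreq]
  rw [hrepr, integral_norm_sq_realTrigPoly neg_mem_freqBall_one (isConjSymm_marchioroForceCoeff β),
    ← Finset.sum_subset hpair fun k _ hk => ?_]
  · rw [Finset.sum_pair firstModeFreq_ne_neg, marchioroForceCoeff_eq, marchioroForceCoeff_eq,
      if_pos rfl, if_neg firstModeFreq_ne_neg, if_neg (Ne.symm firstModeFreq_ne_neg), if_pos rfl,
      EuclideanSpace.conjVec_zero, add_zero, zero_add, norm_smul, norm_smul,
      EuclideanSpace.norm_conjVec, norm_inv, Complex.norm_ofNat, mul_pow, norm_sq_firstModeCoeff]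
    ring
  · simp only [Finset.mem_insert, Finset.mem_singleton, not_or] at hk
    rw [marchioroForceCoeff_eq_zero hk.1 hk.2, norm_zero, zero_pow two_ne_zero]

/-- **Energy of the laminar state**: `∫ ‖ū‖² = α²/(16π⁴ν²)`, `ū = f_α/(4π²ν)`. [folklore] -/
theorem integral_norm_sq_marchioroLaminarState (α ν : ℝ) :
    ∫ x, ‖marchioroLaminarState α ν x‖ ^ 2 = α ^ 2 / (16 * Real.pi ^ 4 * ν ^ 2) := by
  rw [marchioroLaminarState_eq_marchioroForce, integral_norm_sq_marchioroForce]
  rcases eq_or_ne ν 0 with rfl | hν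
  · simp
  · field_simp
    ring

variable {α ν : ℝ} {u₀ : (UnitAddTorus (Fin 2)) → (EuclideanSpace ℝ (Fin 2))} {u : ℝ → (UnitAddTorus (Fin 2)) → (EuclideanSpace ℝ (Fin 2))}

/-- **The energy of every zero-momentum Leray–Hopf solution under the first-mode force
converges to the laminar energy** `α²/(16π⁴ν²)` as `t → ∞` (Marchioro 1986 / FMRT App. III.A.4
via `Marchioro1986_globalAttraction_holds`, plus `L²`-continuity of the energy). [folklore] -/
theorem tendsto_integral_norm_sq_of_firstMode (hν : 0 < ν) (hu₀ : MemLp u₀ 2 volume)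
    (hmean : HasZeroMean u₀)
    (hu : Torus.IsGlobalLerayHopf ν (fun _ => marchioroForce α) u₀ u) :
    Tendsto (fun t => ∫ x, ‖u t x‖ ^ 2) atTop (𝓝 (α ^ 2 / (16 * Real.pi ^ 4 * ν ^ 2))) := by
  have hM := Marchioro1986_globalAttraction_holds α ν hν u₀ hu₀ hu.isWeaklyDivFree_datum hmean u hu
  rw [← integral_norm_sq_marchioroLaminarState α ν]
  refine tendsto_integral_norm_sq_of_tendsto_eLpNorm ?_ (memLp_marchioroLaminarState α ν 2) hM
  filter_upwards [eventually_ge_atTop 0] with t ht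
  exact hu.memLp_two ht

/-- **Mean energy at the first shell is exactly the laminar one**: for every zero-momentum
global Leray–Hopf solution with force `marchioroForce α` and viscosity `ν > 0`,
`⟨‖u‖²⟩ = α²/(16π⁴ν²)`. TIGHTNESS LEMMA: at fixed first-shell `g = f_α` the mean energy of the
crux's admissible families is `∝ ν⁻²`, with no freedom in the data. [folklore] -/
theorem meanEnergy_eq_of_firstMode (hν : 0 < ν) (hu₀ : MemLp u₀ 2 volume)
    (hmean : HasZeroMean u₀)
    (hu : Torus.IsGlobalLerayHopf ν (fun _ => marchioroForce α) u₀ u) :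
    meanEnergy u = α ^ 2 / (16 * Real.pi ^ 4 * ν ^ 2) := by
  rw [meanEnergy_eq_longTimeAvgSup]
  exact longTimeAvgSup_eq_of_tendsto (fun T hT => hu.integrableOn_integral_norm_sq hT)
    (tendsto_integral_norm_sq_of_firstMode hν hu₀ hmean hu)

/-- **The crux restricted to first-shell forces is FALSE.** For `g = marchioroForce α`, `α ≠ 0`
(a first Stokes eigenfunction, the force named in the crux docstring), NO choice of
viscosities `ν_j → 0` and zero-momentum `L²` data yields Leray–Hopf solutions with bounded mean
energy: `⟨‖v_j‖²⟩ = α²/(16π⁴ν_j²) → ∞`. Refutation of the natural special case / of the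
strengthening "the witness force may be taken in the first shell". [folklore] -/
theorem not_TwodBoundedEnergyZeroMomentum_firstMode :
    ¬ ∃ α : ℝ, α ≠ 0 ∧ ∃ (ν : ℕ → ℝ) (v₀ : ℕ → (UnitAddTorus (Fin 2)) → (EuclideanSpace ℝ (Fin 2))) (v : ℕ → ℝ → (UnitAddTorus (Fin 2)) → (EuclideanSpace ℝ (Fin 2))),
      (∀ j, 0 < ν j) ∧ Tendsto ν atTop (𝓝 0) ∧
      (∀ j, MemLp (v₀ j) 2 volume ∧ HasZeroMean (v₀ j)) ∧
      (∀ j, Torus.IsGlobalLerayHopf (ν j) (fun _ => marchioroForce α) (v₀ j) (v j)) ∧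
      ∃ E : ℝ, ∀ j, meanEnergy (v j) ≤ E := by
  rintro ⟨α, hα, ν, v₀, v, hν, hν0, hdata, hLH, E, hE⟩
  have hEj : ∀ j, α ^ 2 / (16 * Real.pi ^ 4 * ν j ^ 2) ≤ E := fun j => by
    rw [← meanEnergy_eq_of_firstMode (hν j) (hdata j).1 (hdata j).2 (hLH j)]
    exact hE j
  have hE0 : 0 < E := by
    have h0 : 0 < α ^ 2 / (16 * Real.pi ^ 4 * ν 0 ^ 2) := by
      have := hν 0
      positivity
    exact h0.trans_le (hEj 0)
  -- `ν_j² ≥ α²/(16π⁴E)` contradicts `ν_j → 0`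
  have hlow : ∀ j, α ^ 2 / (16 * Real.pi ^ 4 * E) ≤ ν j ^ 2 := fun j => by
    have h1 := hEj j
    have hνj := hν j
    rw [div_le_iff₀ (by positivity)] at h1
    rw [div_le_iff₀ (by positivity)]
    nlinarith
  have hsq : Tendsto (fun j => ν j ^ 2) atTop (𝓝 0) := by
    simpa using hν0.pow 2
  have hc : 0 < α ^ 2 / (16 * Real.pi ^ 4 * E) := by positivity
  have hev := (tendsto_order.1 hsq).2 _ hc
  obtain ⟨j, hj⟩ := hev.exists
  exact absurd (hlow j) (not_le.2 hj)

end FirstMode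

/-! ### The `∀ g` strengthening is false -/

section Strengthening

/-- **The `∀ g` strengthening of the crux is false**: it is NOT the case that every smooth,
divergence-free, mean-zero `g ≠ 0` admits a zero-momentum bounded-mean-energy Leray–Hopf family
along some `ν_j → 0` — the first-mode force is a counterexample (`not_TwodBoundedEnergyZeroMomentum_firstMode`). So the
existential over `g` in the crux is essential: the witness force must be CHOSEN (off the first
shell). [folklore] -/
theorem not_TwodBoundedEnergyZeroMomentum_forall_force :
    ¬ ∀ g : (UnitAddTorus (Fin 2)) → (EuclideanSpace ℝ (Fin 2)), IsSmooth g → IsDivFree g → HasZeroMean g → g ≠ 0 →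
      ∃ (ν : ℕ → ℝ) (v₀ : ℕ → (UnitAddTorus (Fin 2)) → (EuclideanSpace ℝ (Fin 2))) (v : ℕ → ℝ → (UnitAddTorus (Fin 2)) → (EuclideanSpace ℝ (Fin 2))),
        (∀ j, 0 < ν j) ∧ Tendsto ν atTop (𝓝 0) ∧
        (∀ j, MemLp (v₀ j) 2 volume ∧ HasZeroMean (v₀ j)) ∧
        (∀ j, Torus.IsGlobalLerayHopf (ν j) (fun _ => g) (v₀ j) (v j)) ∧
        ∃ E : ℝ, ∀ j, meanEnergy (v j) ≤ E := by
  intro h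
  have hdiv : IsDivFree (marchioroForce 1) := by
    rw [marchioroForce_eq_realTrigPoly]
    exact isDivFree_realTrigPoly_singleton (sum_mul_firstModeCoeff 1)
  have hmean : HasZeroMean (marchioroForce 1) :=
    hasZeroMean_stokesMode (k := Pi.single 0 1) firstModeFreq_ne_zero _ _
  obtain ⟨ν, v₀, v, hν, hν0, hdata, hLH, hE⟩ :=
    h (marchioroForce 1) (isSmooth_marchioroForce 1) hdiv hmean (marchioroForce_ne_zero one_ne_zero)
  exact not_TwodBoundedEnergyZeroMomentum_firstMode ⟨1, one_ne_zero, ν, v₀, v, hν, hν0, hdata, hLH, hE⟩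

end Strengthening

/-! ### Junk audit: the momentum stays zero and the `limsup` is honest -/

section Honest

variable {ν : ℝ} {g u₀ : (UnitAddTorus (Fin 2)) → (EuclideanSpace ℝ (Fin 2))} {u : ℝ → (UnitAddTorus (Fin 2)) → (EuclideanSpace ℝ (Fin 2))}

/-- **Momentum stays zero.** Under a smooth mean-zero steady force, zero-momentum `L²` data
give zero-momentum slices at every positive time: constant test fields ARE admissible in the
tree's weak formulation (`Torus.IsGlobalLerayHopf.integral_inner_const_eq`), so no Galilean
drift is available to a witness of the crux — the repair of stmt-0209 is effective. [folklore] -/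
theorem hasZeroMean_slice (hg : IsSmooth g) (hg0 : HasZeroMean g) (hu₀ : MemLp u₀ 2 volume)
    (h0 : HasZeroMean u₀) (hu : Torus.IsGlobalLerayHopf ν (fun _ => g) u₀ u) {t : ℝ}
    (ht : 0 < t) : HasZeroMean (u t) := by
  unfold HasZeroMean at h0 ⊢
  have hti : Integrable (u t) volume := (hu.memLp_two ht.le).integrable one_le_two
  have h0i : Integrable u₀ volume := hu₀.integrable one_le_two
  refine ext_inner_left ℝ fun e => ?_
  have h1 : (fun x => ⟪e, u t x⟫_ℝ) = fun x => ⟪u t x, e⟫_ℝ := funext fun x => real_inner_comm _ _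
  have h2 : (fun x => ⟪u₀ x, e⟫_ℝ) = fun x => ⟪e, u₀ x⟫_ℝ := funext fun x => real_inner_comm _ _
  rw [inner_zero_right, ← integral_inner hti e, h1, hu.integral_inner_const_eq hg hg0 e ht, h2,
    integral_inner h0i e, h0, inner_zero_right]

/-- **The `limsup` is honest** (a priori bound; Doering–Foias 2002 §2 /
`Torus.IsGlobalLerayHopf.timeMean_norm_sq_le` at zero momentum): for every admissible
zero-momentum solution of the crux, `⟨‖u‖²⟩ ≤ ½‖u₀‖²/(2π²ν) + ‖g‖₂²/(16π⁴ν²) < ∞`. Hence the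
clause `meanEnergy (v j) ≤ E` can never hold through the junk value (`limsup = 0` on unbounded
Cesàro means): the content of the crux is exactly the UNIFORMITY in `j`. [folklore] -/
theorem meanEnergy_le_apriori (hν : 0 < ν) (hg : IsSmooth g) (hg0 : HasZeroMean g)
    (hu₀ : MemLp u₀ 2 volume) (h0 : HasZeroMean u₀)
    (hu : Torus.IsGlobalLerayHopf ν (fun _ => g) u₀ u) :
    meanEnergy u ≤ kineticEnergy u₀ / (2 * Real.pi ^ 2 * ν) +
      (∫ x, ‖g x‖ ^ 2) / (16 * Real.pi ^ 4 * ν ^ 2) := by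
  have hmom : ∫ x, u 1 x = 0 := hasZeroMean_slice hg hg0 hu₀ h0 hu one_pos
  have hbound : ∀ T, 1 ≤ T → timeMean (fun t => ∫ x, ‖u t x‖ ^ 2) T ≤
      kineticEnergy u₀ / (2 * Real.pi ^ 2 * ν) + (∫ x, ‖g x‖ ^ 2) / (16 * Real.pi ^ 4 * ν ^ 2) := by
    intro T hT
    have := hu.timeMean_norm_sq_le hν hg hg0 hT
    rw [hmom, norm_zero, zero_pow two_ne_zero, mul_zero, zero_add] at this
    exact this
  rw [meanEnergy_eq_longTimeAvgSup, longTimeAvgSup]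
  refine limsup_le_of_le ?_ ((eventually_ge_atTop 1).mono hbound)
  refine Filter.IsBoundedUnder.isCoboundedUnder_le ⟨0, ?_⟩
  exact (eventually_ge_atTop 0).mono fun T hT =>
    timeMean_nonneg (fun t => integral_nonneg fun _ => sq_nonneg _) hT

end Honest

end Summit.AnomalousDissipation.AnomalousDissipation.Theorems.TwodBoundedEnergyZeroMomentum.Negative

end
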